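import Literature.NumberTheory.LFunctions.FordZetaBoundKappa13Ten
import Literature.NumberTheory.LFunctions.FordZetaBoundMain13
import Literature.NumberTheory.LFunctions.FordZetaBound747
import Literature.NumberTheory.LFunctions.VinogradovKorobovLargeHeightWith
import HarnessLib

/-!
# Ford's Theorem 1 with `74.8` from Theorem 2 with constant `13`, and the large-height region of MTY

Topic `Literature/NumberTheory/LFunctions`. Everything in this file is PROVED; no definition and
no named fact is introduced.

The tree certifies Ford's Theorem 2 (K. Ford, Proc. LMS 85 (2002)) with the constant `13` on
`8 ≤ λ ≤ 87` (`FordVK.expSum_bound_mid_lambda`: rows `85 ≤ k ≤ 87` of Table 6.1 reach `12.2–12.9`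
with the tree's `η = 23/20` prime windows) and with `9.463` on `λ ≥ 87`
(`FordVK.expSum_bound_lambda_ge_87`, from Theorems 3–4 of the source). The large-height region of
Mossinghoff–Trudgian–Yang (`zero_bound_large_height_mossinghoff_trudgian_yang`) needs a Richert
bound `|ζ(σ+it)| ≤ A t^{4.45(1−σ)^{3/2}} log^{2/3} t` with `A ≤ 74.9`
(`zero_bound_large_height_of_richertBound`); `FordZetaBoundMain13.lean` (with `κ ≤ 10.1`) gives
only `75.5`. With the sharp `κ`-lemma `FordVK.kappa13_le10'` (`κ ≤ 10`,
`FordZetaBoundKappa13Ten.lean`) the deduction of §7 gives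
`(2 + e^{(34/25)³} + 2·13)/300^{2/3} + 10 · 5.113 · 1.443 = 74.70 ≤ 74.8`:

* `FordVK.dyadic_sum_le13_ten` — the dyadic sum with `(12.38 + 2·13 + 10W) e^{2y³}`;
* `FordVK.zeta_bound748_crude`, `FordVK.zeta_bound748_main_of_tail13` — crude and main ranges;
* `zeta_bound748_of_exp_sum_bound13`, `zeta_bound748_of_exp_sum_bound13_large_lambda`,
  `richertBound748_of_exp_sum_bound13(_large_lambda)` — **Theorem 1 with `74.8` from Theorem 2
  with constant `13`** (for all `λ ≥ 1`, resp. for `λ ≥ 8` only, the range `λ ≤ 8` being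
  `FordVK.expSum_bound_small_lambda`);
* `zero_bound_large_height_of_exp_sum_bound13_large_lambda` — **the MTY large-height region from
  Theorem 2 with constant `13` for `λ ≥ 8`**.

## References
* K. Ford, Proc. London Math. Soc. (3) 85 (2002), 565–633; arXiv:1910.08209 — Theorems 1–2,
  Lemmas 7.1–7.3, §7. [Ford2002]
* M. J. Mossinghoff, T. S. Trudgian, A. Yang, *Explicit zero-free regions for the Riemann
  zeta-function*, Res. Number Theory 10 (2024); arXiv:2212.06867, §5. [MossinghoffTrudgianYangRNT2024]
-/

noncomputable section

open Complex Real Finset MeasureTheory intervalIntegral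

namespace Literature.NumberTheory.LFunctions

namespace FordVK

/-! ## The crude range with `74.8` -/

/-- The crude range (`σ ≤ 15/16` or `t ≤ e^{300}`) with the constant `74.8` (from `74.7`,
`FordVK.zeta_bound747_crude`). [cite: Ford2002, Lemma 7.1] -/
theorem zeta_bound748_crude {σ t : ℝ} (ht : 3 ≤ t) (hσ : 1 / 2 ≤ σ) (hσ1 : σ ≤ 1)
    (h : σ ≤ 15 / 16 ∨ t ≤ Real.exp 300) :
    ‖riemannZeta (σ + t * I)‖
      ≤ 74.8 * t ^ (4.45 * (1 - σ) ^ (3 / 2 : ℝ)) * Real.log t ^ (2 / 3 : ℝ) := by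
  have h1 := zeta_bound747_crude ht hσ hσ1 h
  have ht0 : 0 ≤ t := by linarith
  have h2 : (0 : ℝ) ≤ t ^ (4.45 * (1 - σ) ^ (3 / 2 : ℝ)) * Real.log t ^ (2 / 3 : ℝ) := by
    have : 0 ≤ Real.log t := Real.log_nonneg (by linarith)
    positivity
  nlinarith [h1, h2]

/-! ## The dyadic sum with `10W` -/


/-- **The dyadic sum of minima.** For `a ≥ 0`, `W > 0`, `y ≥ 0` with `aW = 3y²` and every `n`,
`∑_{i < n} min(e^{a i}, 13 e^{a i − i³/W³}) ≤ (12.38 + 2 · 13 + 10 W) e^{2y³}`: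
the terms `i ≤ x* = 1.36 W` are bounded trivially and compared with `∫_0^{x*} e^{ax} dx` (plus the
last term `e^{a x*} ≤ e^{1.36³} e^{2y³} ≤ 12.38 e^{2y³}`), the terms `i > x*` by the unimodal
comparison (`FordVK.sum_Ico_le_integral_add`, two stray terms `≤ 13 e^{2y³}`), and the two
integrals, after `x = Wu`, by the `κ`-lemma `FordVK.kappa13_le10'`.
[cite: Ford2002, Lemma 7.3 (proof)] -/
theorem dyadic_sum_le13_ten {a W y : ℝ} (ha : 0 ≤ a) (hW : 0 < W) (hy : 0 ≤ y)
    (hay : a * W = 3 * y ^ 2) (n : ℕ) :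
    ∑ i ∈ Finset.range n, min (Real.exp (a * i)) (13 * Real.exp (a * i - (i : ℝ) ^ 3 / W ^ 3))
      ≤ (12.38 + 2 * 13 + 10 * W) * Real.exp (2 * y ^ 3) := by
  set C : ℝ := 13 with hC
  have hC0 : (0 : ℝ) ≤ C := by norm_num [hC]
  set E : ℝ := Real.exp (2 * y ^ 3) with hE
  have hE0 : 0 < E := Real.exp_pos _
  set f₁ : ℝ → ℝ := fun x ↦ Real.exp (a * x) with hf₁
  set f₂ : ℝ → ℝ := fun x ↦ C * Real.exp (a * x - x ^ 3 / W ^ 3) with hf₂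
  set xs : ℝ := 34 / 25 * W with hxs
  have hxs0 : 0 ≤ xs := by rw [hxs]; positivity
  set m : ℕ := ⌊xs⌋₊ with hm
  have hmxs : (m : ℝ) ≤ xs := Nat.floor_le hxs0
  have hxsm : xs < (m : ℝ) + 1 := Nat.lt_floor_add_one xs
  -- properties of `f₂`
  have hf₂0 : ∀ x, 0 ≤ f₂ x := fun x ↦ by rw [hf₂]; positivity
  have hf₂F : ∀ x, 0 ≤ x → f₂ x ≤ C * E := fun x hx ↦ by
    rw [hf₂, hE]
    exact mul_le_mul_of_nonneg_left (Real.exp_le_exp.2 (cubic_le_max hW hy hay hx)) hC0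
  have hf₂c : Continuous f₂ := by rw [hf₂]; fun_prop
  have hf₂m : MonotoneOn f₂ (Set.Icc 0 (y * W)) := fun u hu v hv huv ↦ by
    simp only [hf₂]
    exact mul_le_mul_of_nonneg_left (Real.exp_le_exp.2 (cubic_monotone hW hay hu.1 huv hv.2)) hC0
  have hf₂a : AntitoneOn f₂ (Set.Ici (y * W)) := fun u hu v _ huv ↦ by
    simp only [hf₂]
    exact mul_le_mul_of_nonneg_left (Real.exp_le_exp.2 (cubic_antitone hW hy hay hu huv)) hC0
  -- properties of `f₁`
  have hf₁0 : ∀ x, 0 ≤ f₁ x := fun x ↦ by rw [hf₁]; positivity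
  have hf₁m : Monotone f₁ := fun u v huv ↦ by
    simp only [hf₁]; exact Real.exp_le_exp.2 (by nlinarith)
  have hf₁c : Continuous f₁ := by rw [hf₁]; fun_prop
  -- Step 1: split the sum of minima at `m`
  have hsplit : ∑ i ∈ Finset.range n, min (f₁ i) (f₂ i)
      ≤ ∑ i ∈ Finset.range (m + 1), f₁ i + ∑ i ∈ Finset.Ico (m + 1) n, f₂ i := by
    rw [← Finset.sum_filter_add_sum_filter_not (Finset.range n) (fun i ↦ i ≤ m)]
    refine add_le_add ?_ ?_
    · calc ∑ i ∈ (Finset.range n).filter (fun i ↦ i ≤ m), min (f₁ i) (f₂ i)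
          ≤ ∑ i ∈ (Finset.range n).filter (fun i ↦ i ≤ m), f₁ i :=
            Finset.sum_le_sum fun i _ ↦ min_le_left _ _
        _ ≤ ∑ i ∈ Finset.range (m + 1), f₁ i := by
            refine Finset.sum_le_sum_of_subset_of_nonneg ?_ fun i _ _ ↦ hf₁0 i
            intro i hi
            simp only [Finset.mem_filter, Finset.mem_range] at hi ⊢
            omega
    · calc ∑ i ∈ (Finset.range n).filter (fun i ↦ ¬ i ≤ m), min (f₁ i) (f₂ i)
          ≤ ∑ i ∈ (Finset.range n).filter (fun i ↦ ¬ i ≤ m), f₂ i :=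
            Finset.sum_le_sum fun i _ ↦ min_le_right _ _
        _ ≤ ∑ i ∈ Finset.Ico (m + 1) n, f₂ i := by
            refine Finset.sum_le_sum_of_subset_of_nonneg ?_ fun i _ _ ↦ hf₂0 i
            intro i hi
            simp only [Finset.mem_filter, Finset.mem_range, Finset.mem_Ico] at hi ⊢
            omega
  -- Step 2: the trivial part against `∫_0^{xs} f₁ + f₁ xs`
  have hpart1 : ∑ i ∈ Finset.range (m + 1), f₁ i ≤ (∫ x in (0 : ℝ)..xs, f₁ x) + 12.38 * E := by
    rw [Finset.sum_range_succ]
    have h1 : ∑ i ∈ Finset.range m, f₁ i ≤ ∫ x in ((0 : ℕ) : ℝ)..m, f₁ x := by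
      rw [Finset.range_eq_Ico]
      exact MonotoneOn.sum_le_integral_Ico (Nat.zero_le m) (hf₁m.monotoneOn _)
    rw [Nat.cast_zero] at h1
    have h2 : ∫ x in (0 : ℝ)..m, f₁ x ≤ ∫ x in (0 : ℝ)..xs, f₁ x :=
      integral_mono_interval le_rfl (Nat.cast_nonneg m) hmxs
        (Filter.Eventually.of_forall fun x ↦ hf₁0 x) (hf₁c.intervalIntegrable _ _)
    have h3 : f₁ m ≤ 12.38 * E := by
      calc f₁ m ≤ f₁ xs := hf₁m hmxs
        _ = Real.exp (3 * y ^ 2 * (34 / 25)) := by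
            simp only [hf₁, hxs]; congr 1; nlinarith [hay]
        _ ≤ Real.exp ((34 / 25) ^ 3 + 2 * y ^ 3) := by
            apply Real.exp_le_exp.2
            nlinarith [mul_nonneg (sq_nonneg (34 / 25 - y)) (by linarith : 0 ≤ 34 / 25 + 2 * y)]
        _ = Real.exp ((34 / 25) ^ 3) * E := by rw [Real.exp_add]
        _ ≤ 12.38 * E := mul_le_mul_of_nonneg_right exp_cube_us_le hE0.le
    linarith
  -- Step 3: the Theorem-2 part against `∫_{xs}^{V W} f₂ + 2 C E`
  set V : ℝ := max ((n : ℝ) / W) (34 / 25) with hV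
  have hV13 : 34 / 25 ≤ V := le_max_right _ _
  have hVW : xs ≤ V * W := by
    rw [hxs]; exact mul_le_mul_of_nonneg_right hV13 hW.le
  have hpart2 : ∑ i ∈ Finset.Ico (m + 1) n, f₂ i ≤ (∫ x in xs..V * W, f₂ x) + 2 * (C * E) := by
    rcases le_or_gt (m + 1) n with hmn | hmn
    · have h1 := sum_Ico_le_integral_add (mul_nonneg hy hW.le) hf₂c hf₂0 hf₂F hf₂m hf₂a hmn
      have hnV : (n : ℝ) ≤ V * W := by
        have : (n : ℝ) / W ≤ V := le_max_left _ _
        rwa [div_le_iff₀ hW] at this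
      have h2 : ∫ x in ((m + 1 : ℕ) : ℝ)..n, f₂ x ≤ ∫ x in xs..V * W, f₂ x :=
        integral_mono_interval (by push_cast; linarith) (by exact_mod_cast hmn) hnV
          (Filter.Eventually.of_forall fun x ↦ hf₂0 x) (hf₂c.intervalIntegrable _ _)
      linarith
    · rw [Finset.Ico_eq_empty (by omega), Finset.sum_empty]
      have : 0 ≤ ∫ x in xs..V * W, f₂ x := intervalIntegral.integral_nonneg hVW fun x _ ↦ hf₂0 x
      positivity
  -- Step 4: the substitution `x = W u` and the `κ`-lemma
  have exs : xs / W = 34 / 25 := by rw [hxs]; field_simp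
  have eVW : V * W / W = V := by field_simp
  have eax : ∀ x, a * x = 3 * y ^ 2 * (x / W) := fun x ↦ by
    field_simp; linear_combination x * hay
  have hI1 : ∫ x in (0 : ℝ)..xs, f₁ x = W * ∫ u in (0 : ℝ)..34 / 25, Real.exp (3 * y ^ 2 * u) := by
    have e1 : f₁ = fun x ↦ (fun u ↦ Real.exp (3 * y ^ 2 * u)) (x / W) := by
      funext x; simp only [hf₁, eax x]
    rw [e1, intervalIntegral.integral_comp_div _ hW.ne', smul_eq_mul, zero_div, exs]
  have hI2 : ∫ x in xs..V * W, f₂ x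
      = W * (C * ∫ u in (34 / 25 : ℝ)..V, Real.exp (3 * y ^ 2 * u - u ^ 3)) := by
    have e1 : f₂ = fun x ↦ (fun u ↦ C * Real.exp (3 * y ^ 2 * u - u ^ 3)) (x / W) := by
      funext x; simp only [hf₂, eax x, div_pow]
    rw [e1, intervalIntegral.integral_comp_div _ hW.ne', smul_eq_mul,
      intervalIntegral.integral_const_mul, exs, eVW]
  have hκ := kappa13_le10' hy hV13
  have hbr : (∫ u in (0 : ℝ)..34 / 25, Real.exp (3 * y ^ 2 * u))
      + C * ∫ u in (34 / 25 : ℝ)..V, Real.exp (3 * y ^ 2 * u - u ^ 3) ≤ 10 * E := by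
    have e : Real.exp (-2 * y ^ 3) * E = 1 := by rw [hE, ← Real.exp_add]; simp
    have h0 : 0 < Real.exp (-2 * y ^ 3) := Real.exp_pos _
    nlinarith
  -- assemble
  calc ∑ i ∈ Finset.range n, min (f₁ i) (f₂ i)
      ≤ ∑ i ∈ Finset.range (m + 1), f₁ i + ∑ i ∈ Finset.Ico (m + 1) n, f₂ i := hsplit
    _ ≤ ((∫ x in (0 : ℝ)..xs, f₁ x) + 12.38 * E) + ((∫ x in xs..V * W, f₂ x) + 2 * (C * E)) :=
        add_le_add hpart1 hpart2
    _ = (12.38 + 2 * C) * E + W * ((∫ u in (0 : ℝ)..34 / 25, Real.exp (3 * y ^ 2 * u))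
          + C * ∫ u in (34 / 25 : ℝ)..V, Real.exp (3 * y ^ 2 * u - u ^ 3)) := by
        rw [hI1, hI2]; ring
    _ ≤ (12.38 + 2 * C) * E + W * (10 * E) := by gcongr
    _ = (12.38 + 2 * 13 + 10 * W) * E := by rw [hC]; ring

/-! ## The main range with `74.8` from the constant `13` -/

/-- **The main range of Ford's Theorem 1 from Theorem 2 with constant `13`, with `74.8`** (Lemma 7.3
of the source; `FordVK.zeta_bound747_main_of_tail12` verbatim with `12 → 13` and the `κ`-lemma
`FordVK.kappa13_le10'`; last numerical step `2/44.8 + 38.38/44.8 + 73.8 = 74.70 ≤ 74.8`). For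
`15/16 ≤ σ ≤ 1`, `t ≥ e^{300}`, given the tail bound `‖ζ(s) − ∑_{n ≤ ⌊t⌋} n^{−s}‖ ≤ 1` and the
exponential-sum bound (constant `13`) at `u = 0` for this `t` (hypothesis `hS`):
`|ζ(σ + it)| ≤ 74.8 t^{4.45(1−σ)^{3/2}} (log t)^{2/3}`. [cite: Ford2002, Lemma 7.3] -/
theorem zeta_bound748_main_of_tail13 {σ t : ℝ} (hσ : 15 / 16 ≤ σ) (hσ1 : σ ≤ 1)
    (ht : Real.exp 300 ≤ t)
    (htail : ‖riemannZeta (σ + t * I)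
      - ∑ n ∈ Finset.Icc 1 ⌊t⌋₊, (n : ℂ) ^ (-((σ : ℂ) + t * I))‖ ≤ 1)
    (hS : ∀ N R : ℕ, 1 ≤ N → (N : ℝ) ≤ t → N < R → R ≤ 2 * N →
      ‖∑ n ∈ Finset.Ioc N R, (n : ℂ) ^ (-(t * I))‖
        ≤ 13 * (N : ℝ) ^ (1 - Real.log N ^ 2 / (133.66 * Real.log t ^ 2))) :
    ‖riemannZeta (σ + t * I)‖
      ≤ 74.8 * t ^ (4.45 * (1 - σ) ^ (3 / 2 : ℝ)) * Real.log t ^ (2 / 3 : ℝ) := by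
  have h300 : (300 : ℝ) + 1 ≤ Real.exp 300 := Real.add_one_le_exp 300
  have ht0 : 0 < t := by linarith
  have ht1 : 1 ≤ t := by linarith
  have hσ0 : 0 ≤ σ := by linarith
  have h1σ : 0 ≤ 1 - σ := by linarith
  set L : ℝ := Real.log t with hL
  have hL300 : 300 ≤ L := by rw [hL, Real.le_log_iff_exp_le ht0]; exact ht
  have hL0 : 0 < L := by linarith
  obtain ⟨hΛQ, hQ⟩ := main_constants hL300
  set N₁ : ℕ := ⌊t⌋₊ with hN₁
  have hN₁1 : 1 ≤ N₁ := Nat.le_floor (by exact_mod_cast ht1)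
  set s : ℂ := (σ : ℂ) + t * I with hs
  -- Step 1–2: `‖ζ‖ ≤ 2 + ‖∑_{1 < n ≤ N₁} n^{-s}‖`
  have hsplit : ∑ n ∈ Finset.Icc 1 N₁, (n : ℂ) ^ (-s) = 1 + ∑ n ∈ Finset.Ioc 1 N₁, (n : ℂ) ^ (-s) := by
    rw [show Finset.Icc 1 N₁ = Finset.Ioc 0 N₁ from Finset.Icc_add_one_left_eq_Ioc 0 N₁,
      ← Finset.sum_Ioc_consecutive _ (Nat.zero_le 1) hN₁1]
    congr 1
    simp
  have h12 : ‖riemannZeta s‖ ≤ 2 + ‖∑ n ∈ Finset.Ioc 1 N₁, (n : ℂ) ^ (-s)‖ := by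
    set Z : ℂ := riemannZeta s with hZ
    set S : ℂ := ∑ n ∈ Finset.Icc 1 N₁, (n : ℂ) ^ (-s) with hSdef
    set T : ℂ := ∑ n ∈ Finset.Ioc 1 N₁, (n : ℂ) ^ (-s) with hT
    have e : Z = (Z - S) + (1 + T) := by rw [hsplit]; ring
    calc ‖Z‖ = ‖(Z - S) + (1 + T)‖ := congrArg (‖·‖) e
      _ ≤ ‖Z - S‖ + ‖1 + T‖ := norm_add_le _ _
      _ ≤ 1 + (‖(1 : ℂ)‖ + ‖T‖) := add_le_add htail (norm_add_le _ _)
      _ = 2 + ‖T‖ := by simp; ring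
  -- Step 3: dyadic decomposition
  have hdy := norm_sum_Ioc_one_le_dyadic13 hσ0 ht1 hS
  rw [← hN₁, ← hL] at hdy
  -- Step 4: the scale `W` and the parameter `y`
  set Λ : ℝ := (133.66 * L ^ 2) ^ (1 / 3 : ℝ) with hΛ
  have hΛ0 : 0 < Λ := by rw [hΛ]; positivity
  have hΛ3 : Λ ^ 3 = 133.66 * L ^ 2 := by
    rw [hΛ, ← Real.rpow_natCast, ← Real.rpow_mul (by positivity)]; norm_num
  have hlog2 : 0.6931471803 < Real.log 2 := Real.log_two_gt_d9
  have hlog2' : 0 < Real.log 2 := by linarith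
  set W : ℝ := Λ / Real.log 2 with hW
  have hW0 : 0 < W := by rw [hW]; positivity
  have hW3 : Real.log 2 ^ 3 / (133.66 * L ^ 2) = 1 / W ^ 3 := by
    rw [hW, div_pow, hΛ3]; field_simp
  set a : ℝ := (1 - σ) * Real.log 2 with ha
  have ha0 : 0 ≤ a := by rw [ha]; positivity
  have haW : a * W = (1 - σ) * Λ := by rw [ha, hW]; field_simp
  set y : ℝ := Real.sqrt (a * W / 3) with hy
  have hy0 : 0 ≤ y := Real.sqrt_nonneg _
  have hy2 : y ^ 2 = a * W / 3 := by rw [hy, Real.sq_sqrt (by positivity)]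
  have hay : a * W = 3 * y ^ 2 := by rw [hy2]; ring
  -- rewrite the dyadic sum in the form of `dyadic_sum_le13_ten`
  have hdy' : ‖∑ n ∈ Finset.Ioc 1 N₁, (n : ℂ) ^ (-s)‖
      ≤ ∑ i ∈ Finset.range (Nat.log 2 N₁ + 1),
          min (Real.exp (a * i)) (13 * Real.exp (a * i - (i : ℝ) ^ 3 / W ^ 3)) := by
    refine hdy.trans (le_of_eq (Finset.sum_congr rfl fun i _ ↦ ?_))
    rw [hW3, ha]; ring_nf
  have hmain := hdy'.trans (dyadic_sum_le13_ten ha0 hW0 hy0 hay _)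
  -- Step 6: `e^{2y³} ≤ t^{B''}`
  set B'' : ℝ := 4.45 * (1 - σ) ^ (3 / 2 : ℝ) with hB''
  have hB0 : 0 ≤ B'' := by rw [hB'']; positivity
  set P : ℝ := t ^ B'' with hP
  have hP1 : 1 ≤ P := Real.one_le_rpow ht1 hB0
  have hEP : Real.exp (2 * y ^ 3) ≤ P := by
    rw [hP, Real.rpow_def_of_pos ht0, ← hL]
    apply Real.exp_le_exp.2
    have h32 : ((1 - σ) ^ (3 / 2 : ℝ)) ^ 2 = (1 - σ) ^ 3 := by
      rw [← Real.rpow_natCast, ← Real.rpow_mul h1σ]; norm_num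
    have hX : 0 ≤ (1 - σ) ^ 3 * L ^ 2 := by positivity
    have e2 : (2 * y ^ 3) ^ 2 = 4 * 133.66 / 27 * ((1 - σ) ^ 3 * L ^ 2) := by
      have e1 : (2 * y ^ 3) ^ 2 = 4 * (y ^ 2) ^ 3 := by ring
      rw [e1, hy2, haW, div_pow, mul_pow, hΛ3]; ring
    have e3 : (L * B'') ^ 2 = 4.45 ^ 2 * ((1 - σ) ^ 3 * L ^ 2) := by
      rw [hB'', mul_pow, mul_pow, h32]; ring
    have hsq : (2 * y ^ 3) ^ 2 ≤ (L * B'') ^ 2 := by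
      rw [e2, e3]; exact mul_le_mul_of_nonneg_right (by norm_num) hX
    have h2 : 0 ≤ L * B'' := by positivity
    exact (pow_le_pow_iff_left₀ (by positivity) h2 two_ne_zero).1 hsq
  -- Step 7: `W ≤ 7.38 L^{2/3}`
  set Q : ℝ := L ^ (2 / 3 : ℝ) with hQdef
  have hQ0 : 0 ≤ Q := by rw [hQdef]; positivity
  have hWQ : W ≤ 7.38 * Q := by
    have h1 : W ≤ 1.443 * Λ := by
      rw [hW, div_le_iff₀ hlog2']
      nlinarith [mul_nonneg hΛ0.le (by linarith : (0 : ℝ) ≤ 1.443 * Real.log 2 - 1)]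
    calc W ≤ 1.443 * Λ := h1
      _ ≤ 1.443 * (5.113 * Q) := by gcongr
      _ ≤ 7.38 * Q := by nlinarith [hQ0]
  -- Step 8: assemble (`2/44.8 + 36.38/44.8 + 73.8 ≤ 74.8`)
  have hE0 : 0 < Real.exp (2 * y ^ 3) := Real.exp_pos _
  have hfin : ‖riemannZeta s‖ ≤ 2 + (12.38 + 2 * 13 + 10 * W) * Real.exp (2 * y ^ 3) := by
    linarith
  have hWE : W * Real.exp (2 * y ^ 3) ≤ (7.38 * Q) * P := mul_le_mul hWQ hEP hE0.le (by positivity)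
  have hQP : 44.8 * P ≤ Q * P := mul_le_mul_of_nonneg_right hQ (by linarith)
  have hEP' : (12.38 + 2 * 13) * Real.exp (2 * y ^ 3) ≤ (12.38 + 2 * 13) * P :=
    mul_le_mul_of_nonneg_left hEP (by norm_num)
  have hQP0 : 0 ≤ Q * P := by positivity
  calc ‖riemannZeta s‖ ≤ 2 + (12.38 + 2 * 13 + 10 * W) * Real.exp (2 * y ^ 3) := hfin
    _ = 2 + (12.38 + 2 * 13) * Real.exp (2 * y ^ 3) + 10 * (W * Real.exp (2 * y ^ 3)) := by ring
    _ ≤ 2 * P + (12.38 + 2 * 13) * P + 10 * ((7.38 * Q) * P) := by linarith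
    _ ≤ 74.8 * P * Q := by linarith
    _ = 74.8 * t ^ B'' * L ^ (2 / 3 : ℝ) := by rw [hP, hQdef]


/-! ## Theorem 1 with `74.8` from the exponential-sum hypotheses -/

end FordVK

/-! ## Theorem 1 with `74.8` and the MTY region from the exponential-sum hypotheses -/

open FordVK in
/-- **Ford's Theorem 1 with the constant `74.8`, from the exponential-sum bound with constant
`13`.** If, for all integers `1 ≤ N < R ≤ 2N` and reals `t ≥ N`, `0 < u ≤ 1`,
`‖∑_{N < n ≤ R} (n + u)^{−it}‖ ≤ 13 N^{1 − (log N)²/(133.66 (log t)²)}`, then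
`|ζ(σ + it)| ≤ 74.8 t^{4.45 (1−σ)^{3/2}} (log t)^{2/3}` for all `t ≥ 3`, `1/2 ≤ σ ≤ 1`
(crude range `FordVK.zeta_bound748_crude`, main range `zeta_bound748_main_of_tail13` with
`FordVK.norm_zeta_sub_sum_le_one` and the hypothesis at `u = 0`,
`FordVK.norm_sum_Ioc_cpow_le_of_shifted`). [cite: Ford2002, Theorem 1 (proof, §7)] -/
theorem zeta_bound748_of_exp_sum_bound13
    (hT2 : ∀ (N R : ℕ) (t u : ℝ), 1 ≤ N → (N : ℝ) ≤ t → 0 < u → u ≤ 1 → N < R → R ≤ 2 * N →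
      ‖∑ n ∈ Finset.Ioc N R, ((n : ℂ) + u) ^ (-(t * I))‖
        ≤ 13 * (N : ℝ) ^ (1 - Real.log N ^ 2 / (133.66 * Real.log t ^ 2))) :
    ∀ σ t : ℝ, 3 ≤ t → 1 / 2 ≤ σ → σ ≤ 1 →
      ‖riemannZeta (σ + t * I)‖ ≤ 74.8 * t ^ (4.45 * (1 - σ) ^ (3 / 2 : ℝ)) * Real.log t ^ (2 / 3 : ℝ) := by
  intro σ t ht hσ hσ1
  rcases le_or_gt t (Real.exp 300) with h300 | h300
  · exact zeta_bound748_crude ht hσ hσ1 (Or.inr h300)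
  rcases le_or_gt σ (15 / 16) with h15 | h15
  · exact zeta_bound748_crude ht hσ hσ1 (Or.inl h15)
  have hS : ∀ N R : ℕ, 1 ≤ N → (N : ℝ) ≤ t → N < R → R ≤ 2 * N →
      ‖∑ n ∈ Finset.Ioc N R, (n : ℂ) ^ (-(t * I))‖
        ≤ 13 * (N : ℝ) ^ (1 - Real.log N ^ 2 / (133.66 * Real.log t ^ 2)) :=
    fun N R hN hNt hNR hR ↦
      norm_sum_Ioc_cpow_le_of_shifted fun u hu0 hu1 ↦ hT2 N R t u hN hNt hu0 hu1 hNR hR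
  exact zeta_bound748_main_of_tail13 h15.le hσ1 h300.le
    (norm_zeta_sub_sum_le_one h15.le hσ1 h300.le) hS

open FordVK in
/-- **Ford's Theorem 1 with `74.8` from the exponential-sum bound with constant `13` for `λ ≥ 8`
only** (`t ≥ N⁸`); the range `N ≤ t ≤ N⁸` is the theorem `FordVK.expSum_bound_small_lambda`.
[cite: Ford2002, Theorems 1–2] -/
theorem zeta_bound748_of_exp_sum_bound13_large_lambda
    (hT2 : ∀ (N R : ℕ) (t u : ℝ), 1 ≤ N → (N : ℝ) ^ 8 ≤ t → 0 < u → u ≤ 1 → N < R → R ≤ 2 * N →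
      ‖∑ n ∈ Finset.Ioc N R, ((n : ℂ) + u) ^ (-(t * Complex.I))‖
        ≤ 13 * (N : ℝ) ^ (1 - Real.log N ^ 2 / (133.66 * Real.log t ^ 2))) :
    ∀ σ t : ℝ, 3 ≤ t → 1 / 2 ≤ σ → σ ≤ 1 →
      ‖riemannZeta (σ + t * I)‖ ≤ 74.8 * t ^ (4.45 * (1 - σ) ^ (3 / 2 : ℝ)) * Real.log t ^ (2 / 3 : ℝ) :=
  zeta_bound748_of_exp_sum_bound13 fun N R t u hN hNt hu0 hu1 hNR hR => by
    rcases le_or_gt t ((N : ℝ) ^ 8) with h8 | h8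
    · refine (expSum_bound_small_lambda N R t u hN hNt h8 hu0 hu1 hNR hR).trans ?_
      exact mul_le_mul_of_nonneg_right (by norm_num) (by positivity)
    · exact hT2 N R t u hN h8.le hu0 hu1 hNR hR

/-- **`RichertBound 74.8 4.45` from the exponential-sum bound with constant `13`** (two-sided in
`t` by `RichertBound.of_pos`). [cite: Ford2002, Theorems 1–2] -/
theorem richertBound748_of_exp_sum_bound13
    (hT2 : ∀ (N R : ℕ) (t u : ℝ), 1 ≤ N → (N : ℝ) ≤ t → 0 < u → u ≤ 1 → N < R → R ≤ 2 * N →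
      ‖∑ n ∈ Finset.Ioc N R, ((n : ℂ) + u) ^ (-(t * I))‖
        ≤ 13 * (N : ℝ) ^ (1 - Real.log N ^ 2 / (133.66 * Real.log t ^ 2))) :
    RichertBound 74.8 4.45 :=
  RichertBound.of_pos (zeta_bound748_of_exp_sum_bound13 hT2)

/-- **`RichertBound 74.8 4.45` from the exponential-sum bound with constant `13` for `λ ≥ 8`.**
[cite: Ford2002, Theorems 1–2] -/
theorem richertBound748_of_exp_sum_bound13_large_lambda
    (hT2 : ∀ (N R : ℕ) (t u : ℝ), 1 ≤ N → (N : ℝ) ^ 8 ≤ t → 0 < u → u ≤ 1 → N < R → R ≤ 2 * N →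
      ‖∑ n ∈ Finset.Ioc N R, ((n : ℂ) + u) ^ (-(t * Complex.I))‖
        ≤ 13 * (N : ℝ) ^ (1 - Real.log N ^ 2 / (133.66 * Real.log t ^ 2))) :
    RichertBound 74.8 4.45 :=
  RichertBound.of_pos (zeta_bound748_of_exp_sum_bound13_large_lambda hT2)

/-- **The large-height region of Mossinghoff–Trudgian–Yang from Ford's Theorem 2 with constant `13`
for `λ ≥ 8`.** [cite: MossinghoffTrudgianYangRNT2024, §5] [cite: Ford2002, Theorems 1–2] -/
theorem zero_bound_large_height_of_exp_sum_bound13_large_lambda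
    (hT2 : ∀ (N R : ℕ) (t u : ℝ), 1 ≤ N → (N : ℝ) ^ 8 ≤ t → 0 < u → u ≤ 1 → N < R → R ≤ 2 * N →
      ‖∑ n ∈ Finset.Ioc N R, ((n : ℂ) + u) ^ (-(t * Complex.I))‖
        ≤ 13 * (N : ℝ) ^ (1 - Real.log N ^ 2 / (133.66 * Real.log t ^ 2))) :
    zero_bound_large_height_mossinghoff_trudgian_yang :=
  zero_bound_large_height_of_zeta_bound (by norm_num) (by norm_num)
    (zeta_bound748_of_exp_sum_bound13_large_lambda hT2)

end Literature.NumberTheory.LFunctions
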